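import Summits.ResolutionOfSingularities.ResolutionOfSingularities.Theorems.HomologicalConductorNoZenoDiscreteDominator
import HarnessLib

/-!
# Crux `NoZenoR` (stmt-ResolutionOfSingularities-19943): the DATUM-LEVEL termination law —
# a ca-tower terminates iff it is weakly dominated by a noetherian valuation ring (given `StrictDrop`)

OURS (cell res-hironaka, crux chain W4.4; lead res-L0-w44-lead-1 g11, DESK WORD 49 (ii): «state the DATUM-LEVEL law first»; companion of
`…NoZenoDiscreteDominator` p595916).  AI-written, weaker than expert review; nothing here is a statement of the manuscript under review
(Hironaka 2017).  SUPPORT-level, counted 0.  Def-free, fact-free, every transcendence degree.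

* `terminates_iff_discreteDominator (hD : StrictDrop) … : (∃ m, IsRegularLocalRing (T_m)) ↔ ∃ O' noetherian weakly dominating the tower` —
  `→` is `DiscreteDominator.exists_discreteDominator_of_isRegularLocalRing` (StrictDrop NOT used); `←` is dominance invariance
  (`stub_dominanceInvariance`: the `O'`-tower IS the `O`-tower) + the noetherian case (`stub_noetherianCase hD` at the datum `(k, K, O', A)`).
  `StrictDrop` enters only through `←` and is kept as an explicit hypothesis (it is the route's open item stmt-16485).
* `terminates_iff_not_kernel (hD)` — the same law against the registry's kernel binder `hker`: termination ⟺ ¬ hker.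
So at every single datum the crux's case split «noetherian dominator ∨ kernel» is EXHAUSTIVE AND EXCLUSIVE: the kernel is precisely the set
of non-terminating towers, and `NoZenoR` (⟺ `DiscreteDominator.noZenoR_iff_noKernelDatum`) says it is empty.
-/

noncomputable section

-- single-problem summit: the doubled namespace component `ResolutionOfSingularities` is forced
set_option linter.dupNamespace false

namespace Summit.ResolutionOfSingularities.ResolutionOfSingularities.Theorems.NoZeno.DiscreteDominator

open Summit.ResolutionOfSingularities.ResolutionOfSingularities.Theses.HomologicalConductor
open Summit.ResolutionOfSingularities.ResolutionOfSingularities.Theorems.NoZeno.Birth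
open Summit.ResolutionOfSingularities.ResolutionOfSingularities.Theorems
open Summit.ResolutionOfSingularities.ResolutionOfSingularities.Theorems.NoZeno

variable {k K : Type} [Field k] [Field K] [Algebra k K]

/-- **THE TERMINATION LAW (datum level).**  Given `StrictDrop`, the ca-tower of an admissible datum `(k, K, O, A)` reaches a regular stage
iff some NOETHERIAN valuation ring `O'` of `K` weakly dominates it (every stage in `O'`, stage elements invertible in `O'` invertible in `O`).
`→`: the order valuation of the regular stage (`exists_discreteDominator_of_isRegularLocalRing`, no `StrictDrop`); `←`: the `O'`-tower equals
the `O`-tower (`stub_dominanceInvariance`, stages noetherian by `stub_towerNoetherian`) and `StrictDrop` alone terminates a tower along a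
noetherian valuation ring (`stub_noetherianCase`). [this work] -/
theorem terminates_iff_discreteDominator (hD : StrictDrop) (p : ℕ) (hp : p.Prime) [CharP k p]
    (O : ValuationSubring K) (A : Subalgebra k K) (hk : ∀ c : k, algebraMap k K c ∈ O) (hA : A.FG)
    (hfr : IsFractionRing ↥A K) (hAO : A.toSubring ≤ O.toSubring) :
    (∃ m : ℕ, IsRegularLocalRing ↥(tower O A m)) ↔
      ∃ O' : ValuationSubring K, IsNoetherianRing ↥O' ∧
        ∀ m : ℕ, ∀ s ∈ tower O A m, s ∈ O' ∧ (s⁻¹ ∈ O' → s⁻¹ ∈ O) := by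
  constructor
  · rintro ⟨M, hM⟩
    exact exists_discreteDominator_of_isRegularLocalRing O A hk hfr hAO M hM
  · rintro ⟨O', hN, hdom⟩
    have hTeq : ∀ m : ℕ, tower O' A m = tower O A m := fun m =>
      stub_dominanceInvariance k K O O' A hk hAO
        (fun n => stub_towerNoetherian k K O A hk hA hfr hAO n) hdom m
    have hk' : ∀ c : k, algebraMap k K c ∈ O' :=
      fun c => (hdom 0 _ ((tower O A 0).algebraMap_mem c)).1
    have hAO' : A.toSubring ≤ O'.toSubring :=
      fun a ha => (hdom 0 a (mem_tower_of_mem O A 0 a ha)).1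
    obtain ⟨m, hm⟩ := stub_noetherianCase hD p hp k K O' A hk' hA hfr hAO' hN
    exact ⟨m, hTeq m ▸ hm⟩

/-- **Termination ⟺ not kernel** (datum level, given `StrictDrop`): the registry's kernel binder `hker` holds at a datum iff its tower never
reaches a regular stage.  The crux's case split «noetherian weak dominator ∨ kernel» is exhaustive and exclusive at every datum. [this work] -/
theorem terminates_iff_not_kernel (hD : StrictDrop) (p : ℕ) (hp : p.Prime) [CharP k p]
    (O : ValuationSubring K) (A : Subalgebra k K) (hk : ∀ c : k, algebraMap k K c ∈ O) (hA : A.FG)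
    (hfr : IsFractionRing ↥A K) (hAO : A.toSubring ≤ O.toSubring) :
    (∃ m : ℕ, IsRegularLocalRing ↥(tower O A m)) ↔
      ¬ ∀ O' : ValuationSubring K,
        (∀ m : ℕ, ∀ s ∈ tower O A m, s ∈ O' ∧ (s⁻¹ ∈ O' → s⁻¹ ∈ O)) → ¬ IsNoetherianRing ↥O' := by
  rw [terminates_iff_discreteDominator hD p hp O A hk hA hfr hAO]
  constructor
  · rintro ⟨O', hN, hdom⟩ hker
    exact hker O' hdom hN
  · intro h
    by_contra hno
    exact h fun O' hdom hN => hno ⟨O', hN, hdom⟩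

/-- **Along a noetherian valuation ring the law is unconditional in `O'`**: `O` itself is the weak dominator, so (given `StrictDrop`) every
tower along a discrete rank-one or trivial valuation terminates — the by-name form of `stub_noetherianCase` through the law; this is the case of
the kill test `SurfaceTermination` along PRIME DIVISORS (tree `SurfaceTermination.Reduction.surfaceTermination_of_strictDrop`). [this work] -/
theorem terminates_of_isNoetherianRing_valuationSubring (hD : StrictDrop) (p : ℕ) (hp : p.Prime) [CharP k p]
    (O : ValuationSubring K) (A : Subalgebra k K) (hk : ∀ c : k, algebraMap k K c ∈ O) (hA : A.FG)
    (hfr : IsFractionRing ↥A K) (hAO : A.toSubring ≤ O.toSubring) (hN : IsNoetherianRing ↥O) :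
    ∃ m : ℕ, IsRegularLocalRing ↥(tower O A m) :=
  (terminates_iff_discreteDominator hD p hp O A hk hA hfr hAO).mpr
    ⟨O, hN, fun m s hs => ⟨mem_valuationSubring_of_mem_tower O hk hAO m s hs, id⟩⟩

end Summit.ResolutionOfSingularities.ResolutionOfSingularities.Theorems.NoZeno.DiscreteDominator

end
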